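import Summits.ABC.ABC.Theses.IsogenyGlueCongruence
import Summits.ABC.ABC.Theorems.IsogenyGlueCongruencePolyDegreeOfBoundedPrimesManinBoundOfFacts

/-!
# The Manin packages of route IsogenyGlueCongruence: `SemistableManinBound → SemistableManinBound2`,
# and both from the four named facts (items stmt-ABC-16013, stmt-ABC-16014)

The polynomial Manin package `SemistableManinBound2` (stmt-ABC-16014: `∃ a M₀ : ℝ`, every globally
minimal elliptic `W/ℚ` with a datum at a square-free level `N` has a datum `D'` with
`|c_{D'}| ≤ M₀ · N^a`) is the exponent-`0` shadow of the absolute package `SemistableManinBound`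
(stmt-ABC-16013: `∃ M₀ : ℤ`, a datum with the same newform and `|c_{D'}| ≤ M₀`): take `a := 0`,
`M₀ := ↑M₀` (`semistableManinBound2_of_semistableManinBound`). So stmt-ABC-16014 closes the moment
stmt-ABC-16013 does.

Both packages are KNOWN IN PRINT with `M₀ = 163` and are recorded here CONDITIONALLY on exactly the
four inputs of the tree theorem `maninBound_of_facts` (p114821), two of which are items of this route
(verbatim the Literature facts they name):

* `EdixhovenIntegrality` (stmt-ABC-15990) =
  `Literature.NumberTheory.EllipticCurves.edixhoven_int_of_neronLattice_eq_smul_periodLattice`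
  (Edixhoven 1991, Prop. 2: the Manin constant of the strong Weil curve is an integer, lattice form);
* the universal closure of `ModularParametrizationData.abs_maninConstant_eq_one_of_isSemistable`
  (Česnavičius 2018, Thm. 1.2: `|c₀| = 1` for the optimal datum of a semistable curve);
* `MazurKenkuBound` (stmt-ABC-15125) =
  `Literature.NumberTheory.EllipticCurves.ModularForms.PastenShimura2024_minimalDegree_le_163_mul`
  (Mazur 1978, Thm. 1 + Kenku 1982, as used by Pasten 2024, §3 p. 13);
* `Literature.NumberTheory.EllipticCurves.integral_neronScaling_of_isGloballyMinimal`
  (Silverman ATAEC IV.5.1: a rational multiplier between Néron lattices of globally minimal models is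
  an integer).

Unconditionally the item is out of reach of the tree: by `ModularParametrizationData.exists_datum_c_eq`
the admissible Manin constants of `W` are exactly the integers `k ≠ 0` with `k Λ_f ⊆ Λ_W`, and a bound
on the least of them is `|num(q · λ₀)|` with `Λ_{W₀} = q Λ_f` for the global minimal model `W₀` of
`E_f` (`q ∈ ℚˣ` unconditionally, `exists_isGloballyMinimal_latticeEq_rat`; `q = ±1` is
Edixhoven + Česnavičius) and `λ₀` the least rational multiplier `Λ_{W₀} → Λ_W` (integral by Néron
scaling, of degree `≤ 163` by Mazur–Kenku). Supports stmt-ABC-16014.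
-/

-- single-conjunct summit ABC: the duplicate ABC.ABC is mandated (CONVENTIONS §2)
set_option linter.dupNamespace false

namespace Summit.ABC.ABC.Theorems

open Summit.ABC.ABC.Theses.IsogenyGlueCongruence
open Literature.NumberTheory.EllipticCurves Literature.NumberTheory.EllipticCurves.ModularForms

/-- **`SemistableManinBound → SemistableManinBound2`.** An absolute bound `|c_{D'}| ≤ M₀` for some
datum is a polynomial bound with exponent `a = 0` and constant `↑M₀` (`N^0 = 1`). [folklore] -/
theorem semistableManinBound2_of_semistableManinBound (h : SemistableManinBound) :
    SemistableManinBound2 := by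
  obtain ⟨M₀, hM⟩ := h
  refine ⟨0, (M₀ : ℝ), ?_⟩
  intro N _ W _ _ D hN
  obtain ⟨D', -, hD'⟩ := hM N W D hN
  refine ⟨D', ?_⟩
  rw [Real.rpow_zero, mul_one, ← Int.cast_abs]
  exact_mod_cast hD'

/-- **`SemistableManinBound` from the four named facts, `M₀ = 163`.** Granted Edixhoven's Prop. 2 in
lattice form (route item `EdixhovenIntegrality`, stmt-ABC-15990), Česnavičius's theorem (the universal
closure of `abs_maninConstant_eq_one_of_isSemistable`), the Mazur–Kenku bound (route item
`MazurKenkuBound`, stmt-ABC-15125) and the integrality of Néron scalings between globally minimal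
models (`integral_neronScaling_of_isGloballyMinimal`), every globally minimal elliptic `W/ℚ` with a
datum at a square-free level has a datum with the same newform and `|c| ≤ 163`: this is the tree
theorem `maninBound_of_facts` (the two route items are definitionally the Literature facts it takes).
[cite: EdixhovenManin1991, Prop. 2] [cite: Cesnavicius2018, Thm. 1.2]
[cite: PastenShimura2024, §3 p. 13] [cite: SilvermanATAEC1994, IV.5.1] -/
theorem semistableManinBound_of_facts (hEd : EdixhovenIntegrality)
    (hCes : ∀ {W' : WeierstrassCurve ℚ} {N' : ℕ} [NeZero N']
      (D' : ModularParametrizationData W' N'), D'.abs_maninConstant_eq_one_of_isSemistable)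
    (hMK : MazurKenkuBound) (hNS : integral_neronScaling_of_isGloballyMinimal) :
    SemistableManinBound :=
  ⟨163, fun N _ W _ _ D hN ↦ maninBound_of_facts hEd hCes hMK hNS N W D hN⟩

/-- **`SemistableManinBound2` from the same four named facts** (`a = 0`, `M₀ = 163`): compose
`semistableManinBound_of_facts` with `semistableManinBound2_of_semistableManinBound`.
[cite: EdixhovenManin1991, Prop. 2] [cite: Cesnavicius2018, Thm. 1.2]
[cite: PastenShimura2024, §3 p. 13] [cite: SilvermanATAEC1994, IV.5.1] -/
theorem semistableManinBound2_of_facts (hEd : EdixhovenIntegrality)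
    (hCes : ∀ {W' : WeierstrassCurve ℚ} {N' : ℕ} [NeZero N']
      (D' : ModularParametrizationData W' N'), D'.abs_maninConstant_eq_one_of_isSemistable)
    (hMK : MazurKenkuBound) (hNS : integral_neronScaling_of_isGloballyMinimal) :
    SemistableManinBound2 :=
  semistableManinBound2_of_semistableManinBound (semistableManinBound_of_facts hEd hCes hMK hNS)

/-! ## The fact-free residue: a bound on ONE admissible multiplier suffices -/

/-- **`SemistableManinBound` is a statement about lattices only.** If every globally minimal elliptic
`W/ℚ` with a datum `D` at a square-free level `N` admits a nonzero INTEGER multiplier `k` of the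
period lattice into the Néron lattice, `k Λ_f ⊆ Λ_W`, with `|k| ≤ M₀`, then `SemistableManinBound`
holds with the same `M₀`: the datum `D` may be given the Manin constant `k`
(`ModularParametrizationData.exists_datum_c_eq`, which keeps the newform). This direction uses no
named fact; it isolates what the four facts are needed for (bounding the least admissible `k`).
[folklore] -/
theorem semistableManinBound_of_multiplier_bound
    (h : ∃ M₀ : ℤ, ∀ (N : ℕ) [NeZero N] (W : WeierstrassCurve ℚ) [W.IsElliptic] [W.IsGloballyMinimal]
      (D : ModularParametrizationData W N), Squarefree N →
      ∃ k : ℤ, k ≠ 0 ∧ (∀ z ∈ periodLattice D.f, (k : ℂ) * z ∈ D.L.lattice) ∧ |k| ≤ M₀) :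
    SemistableManinBound := by
  obtain ⟨M₀, h⟩ := h
  refine ⟨M₀, fun N _ W _ _ D hN ↦ ?_⟩
  obtain ⟨k, hk0, hk, hbound⟩ := h N W D hN
  obtain ⟨Dk, hf, -, -, hc⟩ := D.exists_datum_c_eq hk0 hk
  refine ⟨Dk, hf, ?_⟩
  show |Dk.c| ≤ M₀
  rwa [hc]

/-- **`SemistableManinBound2` is a statement about lattices only** (polynomial form): if every
globally minimal elliptic `W/ℚ` with a datum `D` at a square-free level `N` admits a nonzero integer
multiplier `k Λ_f ⊆ Λ_W` with `|k| ≤ M₀ · N^a`, then `SemistableManinBound2` holds with the same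
`a, M₀` (`ModularParametrizationData.exists_datum_c_eq`). No named fact is used. [folklore] -/
theorem semistableManinBound2_of_multiplier_bound
    (h : ∃ a M₀ : ℝ, ∀ (N : ℕ) [NeZero N] (W : WeierstrassCurve ℚ) [W.IsElliptic]
      [W.IsGloballyMinimal] (D : ModularParametrizationData W N), Squarefree N →
      ∃ k : ℤ, k ≠ 0 ∧ (∀ z ∈ periodLattice D.f, (k : ℂ) * z ∈ D.L.lattice) ∧
        |(k : ℝ)| ≤ M₀ * (N : ℝ) ^ a) :
    SemistableManinBound2 := by
  obtain ⟨a, M₀, h⟩ := h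
  refine ⟨a, M₀, fun N _ W _ _ D hN ↦ ?_⟩
  obtain ⟨k, hk0, hk, hbound⟩ := h N W D hN
  obtain ⟨Dk, -, -, -, hc⟩ := D.exists_datum_c_eq hk0 hk
  refine ⟨Dk, ?_⟩
  show |((Dk.c : ℤ) : ℝ)| ≤ M₀ * (N : ℝ) ^ a
  rwa [hc]

/-- **Conversely, `SemistableManinBound` gives the multiplier bound**: the Manin constant `k = c_{D'}`
of the datum `D'` it provides is a nonzero integer (`maninConstant_ne_zero_holds`) with
`k Λ_f ⊆ Λ_W`, because `D'` has the newform of `D` and all Néron-type period pairs of `W` span the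
same lattice (`IsNeronLatticeOf.lattice_eq`). [folklore] -/
theorem multiplier_bound_of_semistableManinBound (h : SemistableManinBound) :
    ∃ M₀ : ℤ, ∀ (N : ℕ) [NeZero N] (W : WeierstrassCurve ℚ) [W.IsElliptic] [W.IsGloballyMinimal]
      (D : ModularParametrizationData W N), Squarefree N →
      ∃ k : ℤ, k ≠ 0 ∧ (∀ z ∈ periodLattice D.f, (k : ℂ) * z ∈ D.L.lattice) ∧ |k| ≤ M₀ := by
  obtain ⟨M₀, h⟩ := h
  refine ⟨M₀, fun N _ W _ _ D hN ↦ ?_⟩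
  obtain ⟨D', hf, hD'⟩ := h N W D hN
  refine ⟨D'.c, D'.maninConstant_ne_zero_holds, fun z hz ↦ ?_, hD'⟩
  rw [← D'.isNeronLattice.lattice_eq D.isNeronLattice]
  exact D'.smul_periodLattice_le z (hf ▸ hz)

/-- **Conversely, `SemistableManinBound2` gives the polynomial multiplier bound**: the Manin
constant `k = c_{D'}` of the datum `D'` it provides is a nonzero integer with `k Λ_f ⊆ Λ_W`, since
the newform of `W` at level `N` is unique (`IsNewformOf.unique`) and all Néron-type period pairs of
`W` span the same lattice (`IsNeronLatticeOf.lattice_eq`). [folklore] -/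
theorem multiplier_bound_of_semistableManinBound2 (h : SemistableManinBound2) :
    ∃ a M₀ : ℝ, ∀ (N : ℕ) [NeZero N] (W : WeierstrassCurve ℚ) [W.IsElliptic]
      [W.IsGloballyMinimal] (D : ModularParametrizationData W N), Squarefree N →
      ∃ k : ℤ, k ≠ 0 ∧ (∀ z ∈ periodLattice D.f, (k : ℂ) * z ∈ D.L.lattice) ∧
        |(k : ℝ)| ≤ M₀ * (N : ℝ) ^ a := by
  obtain ⟨a, M₀, h⟩ := h
  refine ⟨a, M₀, fun N _ W _ _ D hN ↦ ?_⟩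
  obtain ⟨D', hD'⟩ := h N W D hN
  have hf : D'.f = D.f := D'.isNewformOf.unique D.isNewformOf
  refine ⟨D'.c, D'.maninConstant_ne_zero_holds, fun z hz ↦ ?_, hD'⟩
  rw [← D'.isNeronLattice.lattice_eq D.isNeronLattice]
  exact D'.smul_periodLattice_le z (hf ▸ hz)

/-- **The exact content of `SemistableManinBound`, fact-free:** it is EQUIVALENT to the lattice
statement "every globally minimal elliptic `W/ℚ` with a datum at a square-free level has a nonzero
integer multiplier `k Λ_f ⊆ Λ_W` with `|k| ≤ M₀`" (`exists_datum_c_eq` one way, the datum's own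
Manin constant the other). [folklore] -/
theorem semistableManinBound_iff_multiplier_bound :
    SemistableManinBound ↔
    ∃ M₀ : ℤ, ∀ (N : ℕ) [NeZero N] (W : WeierstrassCurve ℚ) [W.IsElliptic] [W.IsGloballyMinimal]
      (D : ModularParametrizationData W N), Squarefree N →
      ∃ k : ℤ, k ≠ 0 ∧ (∀ z ∈ periodLattice D.f, (k : ℂ) * z ∈ D.L.lattice) ∧ |k| ≤ M₀ :=
  ⟨multiplier_bound_of_semistableManinBound, semistableManinBound_of_multiplier_bound⟩

/-- **The exact content of `SemistableManinBound2`, fact-free:** it is EQUIVALENT to the lattice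
statement "every globally minimal elliptic `W/ℚ` with a datum at a square-free level `N` has a
nonzero integer multiplier `k Λ_f ⊆ Λ_W` with `|k| ≤ M₀ · N^a`". [folklore] -/
theorem semistableManinBound2_iff_multiplier_bound :
    SemistableManinBound2 ↔
    ∃ a M₀ : ℝ, ∀ (N : ℕ) [NeZero N] (W : WeierstrassCurve ℚ) [W.IsElliptic]
      [W.IsGloballyMinimal] (D : ModularParametrizationData W N), Squarefree N →
      ∃ k : ℤ, k ≠ 0 ∧ (∀ z ∈ periodLattice D.f, (k : ℂ) * z ∈ D.L.lattice) ∧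
        |(k : ℝ)| ≤ M₀ * (N : ℝ) ^ a :=
  ⟨multiplier_bound_of_semistableManinBound2, semistableManinBound2_of_multiplier_bound⟩

end Summit.ABC.ABC.Theorems
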